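import Mathlib
import HarnessLib
import Summits.NavierStokesRegularity.NavierStokesRegularity.Theorems.LrcModEntire.Negative.TwistedColumnField

/-!
# Route `PoloidalWindowDoor`, crux `PoloidalWindowRigidity` (stmt-19708), line `sparse_energy` (cstrat g11) —
# rung R3: THE TWISTED COLUMN (refuter1's K-47 witness) IS NOT SPARSE

Seat ns-poloidal-K2-p2 g9 (successor of the interim LEAD-of-record on 19708; file `--supports`).  Line card
`Cruxes/PoloidalWindowRigidity/Lines/sparse_energy.md` §First rungs, R3: «K-47 is not sparse:
`¬ (∃ K, ∀ R>0, ∫⁻_{ball 0 R} ‖twistProfile t x‖² ≤ K R)` for a time with `cellAmp t ≠ 0` (S/M; documents that the new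
hypothesis bites the refuter's witness family)».

The twisted column `V(x) = (−P₁(x₂) sin x₀, −Q₁(x₂) sin x₁, P(x₂) cos x₀ + Q(x₂) cos x₁)` of
`…LrcModEntire.Negative.TwistedColumnODE` (profile `twistProfile t x = cellAmp t • V x`, `cellAmp t = (−t)^{-1/2}`) is the
(M)-free witness showing that the twisting (TH) stratum of the crux is locally INHABITED (`twistingTH_false_without_mild`).  Line
`sparse_energy` adds to the residue stub S2 the class-level hypothesis delivered by its stub S1 (`stub_scaledEnergy`): the
scale-invariant energy `R⁻¹ ∫_{B_R(a)} |v(t₀)|²` is bounded.  This file proves that the witness VIOLATES that hypothesis: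

* `half_le_twistP₁_sq_add_twistQ₁_sq` : `P₁² + Q₁² ≥ 1/2` at every height (Wronskian `P₁Q − Q₁P = −1`, `|P|, |Q| ≤ 1`);
* `norm_sq_twistField_ge` : on the cores `{sin² x₀ ≥ 3/4, sin² x₁ ≥ 3/4}` one has `‖V(x)‖² ≥ 3/8`;
* `ball_subset_core` : the ball of radius `1/2` about every lattice point `q(k,l,m) = (π/2 + kπ, π/2 + lπ, m)` lies in the cores
  (the lattice map `q` is a section variable pinned by an equation `hq`, so the file declares no definitions);
* `exists_ball_energy_gt` : for every `t < 0` and every `K` there is `R > 0` with `∫⁻_{B_R(0)} ‖twistProfile t‖² > K·R`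
  (the `(2N+1)³` disjoint lattice balls inside `B_{9N+5}(0)` carry energy `≥ (3/8)(−t)⁻¹ · (2N+1)³ · |B_{1/2}|`, cubic in `N`);
* `twistProfile_not_sparse` : R3 verbatim; `twistProfile_not_scaledEnergy` : the conclusion of S1 (`stub_scaledEnergy`, both
  conjuncts, all `t₀, a, R`) FAILS for `v = twistProfile` — so S2's extra hypothesis excludes exactly refuter1's witness family
  (xₕ-periodic columns have ball energy `≍ R³`, not `≲ R`).

WHAT THIS IS NOT: not a claim about Navier–Stokes — an energy count for a kinematic witness (bears_on LADDER-NS N0 via crux 19708,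
line sparse_energy, rung R3). [folklore]
-/

noncomputable section

-- the summit and its single sub-problem share the name (CONVENTIONS §1), as in every Theorems file
set_option linter.dupNamespace false

namespace Summit.NavierStokesRegularity.NavierStokesRegularity.Theorems.PoloidalWindowDoorPoloidalWindowRigiditySparseEnergyTwistProfileNotSparse

open MeasureTheory Set Function Filter Topology Metric
open scoped ENNReal
open Summit.NavierStokesRegularity.NavierStokesRegularity.Theorems.LrcModEntire.Negative
open Summit.NavierStokesRegularity.NavierStokesRegularity.Theorems.PoloidalWindowRigidity.Negative

/-! ### Pointwise lower bounds -/

/-- `P₁² + Q₁² ≥ 1/2` at every height: `1 = |P₁Q − Q₁P| ≤ |P₁| + |Q₁|` and `(|P₁| + |Q₁|)² ≤ 2(P₁² + Q₁²)`. [folklore] -/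
theorem half_le_twistP₁_sq_add_twistQ₁_sq (h : ℝ) : 1 / 2 ≤ twistP₁ h ^ 2 + twistQ₁ h ^ 2 := by
  have hw := twistWronskian h
  have hP := abs_twistP_le h
  have hQ := abs_twistQ_le h
  have h1 : 1 ≤ |twistP₁ h| + |twistQ₁ h| := by
    have habs : |twistP₁ h * twistQ h - twistQ₁ h * twistP h| = 1 := by rw [hw]; norm_num
    calc (1 : ℝ) = |twistP₁ h * twistQ h - twistQ₁ h * twistP h| := habs.symm
      _ ≤ |twistP₁ h * twistQ h| + |twistQ₁ h * twistP h| := abs_sub _ _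
      _ = |twistP₁ h| * |twistQ h| + |twistQ₁ h| * |twistP h| := by rw [abs_mul, abs_mul]
      _ ≤ |twistP₁ h| * 1 + |twistQ₁ h| * 1 := by gcongr
      _ = |twistP₁ h| + |twistQ₁ h| := by ring
  nlinarith [sq_abs (twistP₁ h), sq_abs (twistQ₁ h), sq_nonneg (|twistP₁ h| - |twistQ₁ h|),
    abs_nonneg (twistP₁ h), abs_nonneg (twistQ₁ h)]

/-- A coordinate difference is bounded by the Euclidean distance. [folklore] -/
theorem abs_sub_apply_le_dist (x y : EuclideanSpace ℝ (Fin 3)) (i : Fin 3) : |x i - y i| ≤ dist x y := by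
  rw [dist_eq_norm, ← PiLp.sub_apply, ← Real.norm_eq_abs]
  have hsq : ‖x - y‖ ^ 2 = ∑ j, ‖(x - y) j‖ ^ 2 := EuclideanSpace.norm_sq_eq (x - y)
  have hle : ‖(x - y) i‖ ^ 2 ≤ ∑ j, ‖(x - y) j‖ ^ 2 :=
    Finset.single_le_sum (f := fun j => ‖(x - y) j‖ ^ 2) (fun j _ => sq_nonneg _) (Finset.mem_univ i)
  rw [← hsq] at hle
  exact (pow_le_pow_iff_left₀ (norm_nonneg _) (norm_nonneg _) two_ne_zero).1 hle

/-- `‖V(x)‖² ≥ V₀(x)² + V₁(x)²`. [folklore] -/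
theorem sq_add_sq_le_norm_sq_twistField (x : EuclideanSpace ℝ (Fin 3)) :
    (twistField x 0) ^ 2 + (twistField x 1) ^ 2 ≤ ‖twistField x‖ ^ 2 := by
  rw [EuclideanSpace.norm_sq_eq, Fin.sum_univ_three, Real.norm_eq_abs, Real.norm_eq_abs, Real.norm_eq_abs, sq_abs,
    sq_abs, sq_abs]
  nlinarith [sq_nonneg (twistField x 2)]

/-- On the cores `{sin² x₀ ≥ 3/4, sin² x₁ ≥ 3/4}`: `‖V(x)‖² ≥ 3/8`. [folklore] -/
theorem norm_sq_twistField_ge {x : EuclideanSpace ℝ (Fin 3)} (h0 : 3 / 4 ≤ Real.sin (x 0) ^ 2) (h1 : 3 / 4 ≤ Real.sin (x 1) ^ 2) :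
    3 / 8 ≤ ‖twistField x‖ ^ 2 := by
  have hV := sq_add_sq_le_norm_sq_twistField x
  rw [twistField_apply_zero, twistField_apply_one] at hV
  have hPQ := half_le_twistP₁_sq_add_twistQ₁_sq (x 2)
  have e0 : (-(twistP₁ (x 2) * Real.sin (x 0))) ^ 2 = twistP₁ (x 2) ^ 2 * Real.sin (x 0) ^ 2 := by ring
  have e1 : (-(twistQ₁ (x 2) * Real.sin (x 1))) ^ 2 = twistQ₁ (x 2) ^ 2 * Real.sin (x 1) ^ 2 := by ring
  rw [e0, e1] at hV
  nlinarith [mul_le_mul_of_nonneg_left h0 (sq_nonneg (twistP₁ (x 2))),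
    mul_le_mul_of_nonneg_left h1 (sq_nonneg (twistQ₁ (x 2)))]

/-- Near the lattice of maxima of `sin²`: `|u| ≤ 1/2 ⇒ sin²(π/2 + kπ + u) ≥ 3/4`. [folklore] -/
theorem sin_sq_ge_near_lattice (k : ℤ) {u : ℝ} (hu : |u| ≤ 1 / 2) :
    3 / 4 ≤ Real.sin (Real.pi / 2 + k * Real.pi + u) ^ 2 := by
  have hs : Real.sin (Real.pi / 2 + k * Real.pi + u) = (-1) ^ k * Real.cos u := by
    rw [show Real.pi / 2 + k * Real.pi + u = (u + Real.pi / 2) + k * Real.pi by ring, Real.sin_add_int_mul_pi,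
      Real.sin_add_pi_div_two]
  have habs : |Real.sin (Real.pi / 2 + k * Real.pi + u)| = |Real.cos u| := by
    rw [hs, abs_mul, abs_neg_one_zpow, one_mul]
  have hsq : Real.sin (Real.pi / 2 + k * Real.pi + u) ^ 2 = Real.cos u ^ 2 := by
    rw [← sq_abs, habs, sq_abs]
  rw [hsq]
  have hc := Real.one_sub_sq_div_two_le_cos (x := u)
  have hu2 : u ^ 2 ≤ 1 / 4 := by
    have h := abs_le.1 hu
    nlinarith [h.1, h.2]
  have hc78 : 7 / 8 ≤ Real.cos u := by linarith
  nlinarith [hc78]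

/-! ### The lattice of cores (no definitions: the lattice map `q` is a section variable pinned by `hq`) -/

section Lattice

variable {q : ℤ × ℤ × ℤ → EuclideanSpace ℝ (Fin 3)}
  (hq : ∀ p, q p = (Real.pi / 2 + p.1 * Real.pi) • (EuclideanSpace.single (0 : Fin 3) (1 : ℝ) : EuclideanSpace ℝ (Fin 3)) + (Real.pi / 2 + p.2.1 * Real.pi) • (EuclideanSpace.single (1 : Fin 3) (1 : ℝ) : EuclideanSpace ℝ (Fin 3)) + (p.2.2 : ℝ) • (EuclideanSpace.single (2 : Fin 3) (1 : ℝ) : EuclideanSpace ℝ (Fin 3)))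
include hq

/-- Coordinates of the lattice point `q(k,l,m) = (π/2 + kπ, π/2 + lπ, m)`. [folklore] -/
theorem latticePt_apply_zero (p : ℤ × ℤ × ℤ) : q p 0 = Real.pi / 2 + p.1 * Real.pi := by
  rw [hq]; simp

/-- Coordinates of the lattice point. [folklore] -/
theorem latticePt_apply_one (p : ℤ × ℤ × ℤ) : q p 1 = Real.pi / 2 + p.2.1 * Real.pi := by
  rw [hq]; simp

/-- Coordinates of the lattice point. [folklore] -/
theorem latticePt_apply_two (p : ℤ × ℤ × ℤ) : q p 2 = (p.2.2 : ℝ) := by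
  rw [hq]; simp

/-- Norm of the lattice point: `‖q(k,l,m)‖ ≤ |π/2 + kπ| + |π/2 + lπ| + |m|`. [folklore] -/
theorem norm_latticePt_le (p : ℤ × ℤ × ℤ) :
    ‖q p‖ ≤ |Real.pi / 2 + p.1 * Real.pi| + |Real.pi / 2 + p.2.1 * Real.pi| + |(p.2.2 : ℝ)| := by
  have e0 : ‖(EuclideanSpace.single (0 : Fin 3) (1 : ℝ) : EuclideanSpace ℝ (Fin 3))‖ = 1 := by simp
  have e1 : ‖(EuclideanSpace.single (1 : Fin 3) (1 : ℝ) : EuclideanSpace ℝ (Fin 3))‖ = 1 := by simp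
  have e2 : ‖(EuclideanSpace.single (2 : Fin 3) (1 : ℝ) : EuclideanSpace ℝ (Fin 3))‖ = 1 := by simp
  rw [hq]
  refine (norm_add_le _ _).trans ?_
  refine (add_le_add (norm_add_le _ _) le_rfl).trans ?_
  rw [norm_smul, norm_smul, norm_smul, e0, e1, e2, mul_one, mul_one, mul_one, Real.norm_eq_abs, Real.norm_eq_abs,
    Real.norm_eq_abs]

/-- The ball of radius `1/2` about a lattice point lies in the cores. [folklore] -/
theorem ball_subset_core {p : ℤ × ℤ × ℤ} {x : EuclideanSpace ℝ (Fin 3)} (hx : x ∈ ball (q p) (1 / 2)) :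
    3 / 4 ≤ Real.sin (x 0) ^ 2 ∧ 3 / 4 ≤ Real.sin (x 1) ^ 2 := by
  rw [mem_ball] at hx
  have h0 : |x 0 - q p 0| ≤ 1 / 2 := by
    have h := abs_sub_apply_le_dist x (q p) 0
    linarith
  have h1 : |x 1 - q p 1| ≤ 1 / 2 := by
    have h := abs_sub_apply_le_dist x (q p) 1
    linarith
  rw [latticePt_apply_zero hq] at h0
  rw [latticePt_apply_one hq] at h1
  constructor
  · have h := sin_sq_ge_near_lattice p.1 h0
    rwa [show Real.pi / 2 + p.1 * Real.pi + (x 0 - (Real.pi / 2 + p.1 * Real.pi)) = x 0 by ring] at h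
  · have h := sin_sq_ge_near_lattice p.2.1 h1
    rwa [show Real.pi / 2 + p.2.1 * Real.pi + (x 1 - (Real.pi / 2 + p.2.1 * Real.pi)) = x 1 by ring] at h

/-- On a lattice ball the profile has energy density `‖twistProfile t x‖² ≥ (3/8)·cellAmp t²`. [folklore] -/
theorem norm_sq_twistProfile_ge (t : ℝ) {p : ℤ × ℤ × ℤ} {x : EuclideanSpace ℝ (Fin 3)} (hx : x ∈ ball (q p) (1 / 2)) :
    3 / 8 * cellAmp t ^ 2 ≤ ‖twistProfile t x‖ ^ 2 := by
  obtain ⟨h0, h1⟩ := ball_subset_core hq hx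
  have hV := norm_sq_twistField_ge h0 h1
  have hn : ‖twistProfile t x‖ = cellAmp t * ‖twistField x‖ := by
    rw [twistProfile, norm_smul, Real.norm_eq_abs, abs_of_nonneg (cellAmp_nonneg t)]
  rw [hn, mul_pow]
  nlinarith [sq_nonneg (cellAmp t)]

/-- Distinct lattice points are at distance `≥ 1`. [folklore] -/
theorem one_le_dist_latticePt {p p' : ℤ × ℤ × ℤ} (hne : p ≠ p') : 1 ≤ dist (q p) (q p') := by
  have hπ : 1 ≤ Real.pi := by linarith [Real.pi_gt_three]
  have hc : ∀ i : Fin 3, |q p i - q p' i| ≤ dist (q p) (q p') :=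
    fun i => abs_sub_apply_le_dist (q p) (q p') i
  by_cases hk : p.1 = p'.1
  · by_cases hl : p.2.1 = p'.2.1
    · have hm : p.2.2 ≠ p'.2.2 := by
        intro hm; exact hne (Prod.ext hk (Prod.ext hl hm))
      have h := hc 2
      rw [latticePt_apply_two hq, latticePt_apply_two hq] at h
      have hz : (1 : ℝ) ≤ |((p.2.2 : ℝ)) - (p'.2.2 : ℝ)| := by
        have h1 : (1 : ℤ) ≤ |p.2.2 - p'.2.2| := Int.one_le_abs (sub_ne_zero.2 hm)
        have h2 : ((1 : ℤ) : ℝ) ≤ ((|p.2.2 - p'.2.2| : ℤ) : ℝ) := by exact_mod_cast h1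
        rw [Int.cast_abs, Int.cast_sub] at h2
        exact_mod_cast h2
      exact hz.trans h
    · have h := hc 1
      rw [latticePt_apply_one hq, latticePt_apply_one hq] at h
      have hz : (1 : ℝ) ≤ |((p.2.1 : ℝ)) - (p'.2.1 : ℝ)| := by
        have h1 : (1 : ℤ) ≤ |p.2.1 - p'.2.1| := Int.one_le_abs (sub_ne_zero.2 hl)
        have h2 : ((1 : ℤ) : ℝ) ≤ ((|p.2.1 - p'.2.1| : ℤ) : ℝ) := by exact_mod_cast h1
        rw [Int.cast_abs, Int.cast_sub] at h2
        exact_mod_cast h2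
      have hd : |Real.pi / 2 + p.2.1 * Real.pi - (Real.pi / 2 + p'.2.1 * Real.pi)| =
          |(p.2.1 : ℝ) - (p'.2.1 : ℝ)| * Real.pi := by
        rw [show Real.pi / 2 + p.2.1 * Real.pi - (Real.pi / 2 + p'.2.1 * Real.pi) =
          ((p.2.1 : ℝ) - (p'.2.1 : ℝ)) * Real.pi by ring, abs_mul, abs_of_pos Real.pi_pos]
      rw [hd] at h
      have h3 : (1 : ℝ) ≤ |(p.2.1 : ℝ) - (p'.2.1 : ℝ)| * Real.pi := by nlinarith [abs_nonneg ((p.2.1 : ℝ) - (p'.2.1 : ℝ))]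
      exact h3.trans h
  · have h := hc 0
    rw [latticePt_apply_zero hq, latticePt_apply_zero hq] at h
    have hz : (1 : ℝ) ≤ |((p.1 : ℝ)) - (p'.1 : ℝ)| := by
      have h1 : (1 : ℤ) ≤ |p.1 - p'.1| := Int.one_le_abs (sub_ne_zero.2 hk)
      have h2 : ((1 : ℤ) : ℝ) ≤ ((|p.1 - p'.1| : ℤ) : ℝ) := by exact_mod_cast h1
      rw [Int.cast_abs, Int.cast_sub] at h2
      exact_mod_cast h2
    have hd : |Real.pi / 2 + p.1 * Real.pi - (Real.pi / 2 + p'.1 * Real.pi)| = |(p.1 : ℝ) - (p'.1 : ℝ)| * Real.pi := by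
      rw [show Real.pi / 2 + p.1 * Real.pi - (Real.pi / 2 + p'.1 * Real.pi) = ((p.1 : ℝ) - (p'.1 : ℝ)) * Real.pi by ring,
        abs_mul, abs_of_pos Real.pi_pos]
    rw [hd] at h
    have h3 : (1 : ℝ) ≤ |(p.1 : ℝ) - (p'.1 : ℝ)| * Real.pi := by nlinarith [abs_nonneg ((p.1 : ℝ) - (p'.1 : ℝ))]
    exact h3.trans h

omit hq in
/-- `#[−N, N]³ = (2N+1)³`. [folklore] -/
theorem card_latticeIdx (N : ℕ) : (Finset.Icc (-(N : ℤ)) N ×ˢ (Finset.Icc (-(N : ℤ)) N ×ˢ Finset.Icc (-(N : ℤ)) N)).card = (2 * N + 1) ^ 3 := by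
  have h1 : (Finset.Icc (-(N : ℤ)) N).card = 2 * N + 1 := by
    rw [Int.card_Icc]
    have : (N : ℤ) + 1 - -(N : ℤ) = ((2 * N + 1 : ℕ) : ℤ) := by push_cast; ring
    rw [this, Int.toNat_natCast]
  rw [Finset.card_product, Finset.card_product, h1]
  ring

omit hq in
/-- Coordinates of indices in `[−N, N]³` are bounded by `N`. [folklore] -/
theorem abs_le_of_mem_latticeIdx {N : ℕ} {p : ℤ × ℤ × ℤ} (hp : p ∈ Finset.Icc (-(N : ℤ)) N ×ˢ (Finset.Icc (-(N : ℤ)) N ×ˢ Finset.Icc (-(N : ℤ)) N)) :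
    |(p.1 : ℝ)| ≤ N ∧ |(p.2.1 : ℝ)| ≤ N ∧ |(p.2.2 : ℝ)| ≤ N := by
  simp only [Finset.mem_product, Finset.mem_Icc] at hp
  obtain ⟨⟨hk1, hk2⟩, ⟨hl1, hl2⟩, ⟨hm1, hm2⟩⟩ := hp
  refine ⟨abs_le.2 ⟨?_, ?_⟩, abs_le.2 ⟨?_, ?_⟩, abs_le.2 ⟨?_, ?_⟩⟩ <;> exact_mod_cast (by assumption)

/-- The lattice balls of `[−N, N]³` lie in `B_{9N+5}(0)`. [folklore] -/
theorem ball_latticePt_subset {N : ℕ} {p : ℤ × ℤ × ℤ} (hp : p ∈ Finset.Icc (-(N : ℤ)) N ×ˢ (Finset.Icc (-(N : ℤ)) N ×ˢ Finset.Icc (-(N : ℤ)) N)) :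
    ball (q p) (1 / 2) ⊆ ball (0 : EuclideanSpace ℝ (Fin 3)) (9 * N + 5) := by
  intro x hx
  obtain ⟨hk, hl, hm⟩ := abs_le_of_mem_latticeIdx hp
  have hπ4 := Real.pi_le_four
  have hπ0 := Real.pi_pos.le
  have hqn := norm_latticePt_le hq p
  have ha : |Real.pi / 2 + p.1 * Real.pi| ≤ 2 + 4 * N := by
    refine (abs_add_le _ _).trans ?_
    rw [abs_of_nonneg (by positivity : (0 : ℝ) ≤ Real.pi / 2), abs_mul, abs_of_nonneg hπ0]
    nlinarith [abs_nonneg (p.1 : ℝ)]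
  have hb : |Real.pi / 2 + p.2.1 * Real.pi| ≤ 2 + 4 * N := by
    refine (abs_add_le _ _).trans ?_
    rw [abs_of_nonneg (by positivity : (0 : ℝ) ≤ Real.pi / 2), abs_mul, abs_of_nonneg hπ0]
    nlinarith [abs_nonneg (p.2.1 : ℝ)]
  rw [mem_ball] at hx ⊢
  calc dist x 0 ≤ dist x (q p) + dist (q p) 0 := dist_triangle _ _ _
    _ < 1 / 2 + ‖q p‖ := by rw [dist_zero_right]; linarith
    _ ≤ 9 * N + 5 := by linarith

/-- The lattice balls are pairwise disjoint. [folklore] -/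
theorem pairwiseDisjoint_latticeBalls (N : ℕ) :
    (↑(Finset.Icc (-(N : ℤ)) N ×ˢ (Finset.Icc (-(N : ℤ)) N ×ˢ Finset.Icc (-(N : ℤ)) N)) : Set (ℤ × ℤ × ℤ)).PairwiseDisjoint (fun p => ball (q p) (1 / 2)) := by
  intro p _ p' _ hne
  exact ball_disjoint_ball (by linarith [one_le_dist_latticePt hq hne])

/-- **The lattice balls carry energy cubic in `N`.**  For every `t`:
`ENNReal.ofReal ((3/8)·cellAmp t²) · (2N+1)³ · |B_{1/2}| ≤ ∫⁻_{B_{9N+5}(0)} ‖twistProfile t‖²`. [folklore] -/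
theorem energy_lower_bound_of_lattice (t : ℝ) (N : ℕ) :
    ENNReal.ofReal (3 / 8 * cellAmp t ^ 2) * (((2 * N + 1) ^ 3 : ℕ) * volume (ball (0 : EuclideanSpace ℝ (Fin 3)) (1 / 2))) ≤
      ∫⁻ x in ball (0 : EuclideanSpace ℝ (Fin 3)) (9 * N + 5), ENNReal.ofReal (‖twistProfile t x‖ ^ 2) := by
  set S : Set (EuclideanSpace ℝ (Fin 3)) := ⋃ p ∈ Finset.Icc (-(N : ℤ)) N ×ˢ (Finset.Icc (-(N : ℤ)) N ×ˢ Finset.Icc (-(N : ℤ)) N), ball (q p) (1 / 2) with hS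
  have hSsub : S ⊆ ball (0 : EuclideanSpace ℝ (Fin 3)) (9 * N + 5) := by
    rw [hS]
    exact iUnion₂_subset fun p hp => ball_latticePt_subset hq hp
  have hSvol : volume S = ((2 * N + 1) ^ 3 : ℕ) * volume (ball (0 : EuclideanSpace ℝ (Fin 3)) (1 / 2)) := by
    rw [hS, measure_biUnion_finset (pairwiseDisjoint_latticeBalls hq N) (fun p _ => measurableSet_ball)]
    simp_rw [Measure.addHaar_ball_center volume]
    rw [Finset.sum_const, card_latticeIdx, nsmul_eq_mul]
  have hmeas : Measurable fun x : EuclideanSpace ℝ (Fin 3) => ENNReal.ofReal (‖twistProfile t x‖ ^ 2) := by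
    have hc : Continuous fun x : EuclideanSpace ℝ (Fin 3) => ‖twistProfile t x‖ ^ 2 :=
      (continuous_twistField.const_smul (cellAmp t)).norm.pow 2
    exact hc.measurable.ennreal_ofReal
  calc ENNReal.ofReal (3 / 8 * cellAmp t ^ 2) * (((2 * N + 1) ^ 3 : ℕ) * volume (ball (0 : EuclideanSpace ℝ (Fin 3)) (1 / 2)))
      = ENNReal.ofReal (3 / 8 * cellAmp t ^ 2) * volume S := by rw [hSvol]
    _ = ∫⁻ _ in S, ENNReal.ofReal (3 / 8 * cellAmp t ^ 2) := (setLIntegral_const S _).symm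
    _ ≤ ∫⁻ x in S, ENNReal.ofReal (‖twistProfile t x‖ ^ 2) := by
        refine setLIntegral_mono hmeas fun x hx => ?_
        rw [hS] at hx
        obtain ⟨p, hp, hxp⟩ := mem_iUnion₂.1 hx
        exact ENNReal.ofReal_le_ofReal (norm_sq_twistProfile_ge hq t hxp)
    _ ≤ ∫⁻ x in ball (0 : EuclideanSpace ℝ (Fin 3)) (9 * N + 5), ENNReal.ofReal (‖twistProfile t x‖ ^ 2) :=
        lintegral_mono_set hSsub

end Lattice

/-! ### The energy count -/

/-- **The lattice balls carry energy cubic in `N`.**  For every `t`: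
`ENNReal.ofReal ((3/8)·cellAmp t²) · (2N+1)³ · |B_{1/2}| ≤ ∫⁻_{B_{9N+5}(0)} ‖twistProfile t‖²`. [folklore] -/
theorem energy_lower_bound (t : ℝ) (N : ℕ) :
    ENNReal.ofReal (3 / 8 * cellAmp t ^ 2) * (((2 * N + 1) ^ 3 : ℕ) * volume (ball (0 : EuclideanSpace ℝ (Fin 3)) (1 / 2))) ≤
      ∫⁻ x in ball (0 : EuclideanSpace ℝ (Fin 3)) (9 * N + 5), ENNReal.ofReal (‖twistProfile t x‖ ^ 2) :=
  energy_lower_bound_of_lattice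
    (q := fun p : ℤ × ℤ × ℤ => (Real.pi / 2 + p.1 * Real.pi) • (EuclideanSpace.single (0 : Fin 3) (1 : ℝ) : EuclideanSpace ℝ (Fin 3)) + (Real.pi / 2 + p.2.1 * Real.pi) • (EuclideanSpace.single (1 : Fin 3) (1 : ℝ) : EuclideanSpace ℝ (Fin 3)) + (p.2.2 : ℝ) • (EuclideanSpace.single (2 : Fin 3) (1 : ℝ) : EuclideanSpace ℝ (Fin 3))) (fun _ => rfl) t N

/-- **For every `t < 0` and every `K` the ball energy of the twisted column beats `K·R` at some scale `R > 0`.**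
[folklore] -/
theorem exists_ball_energy_gt {t : ℝ} (ht : t < 0) (K : ℝ) :
    ∃ R : ℝ, 0 < R ∧ ENNReal.ofReal (K * R) < ∫⁻ x in ball (0 : EuclideanSpace ℝ (Fin 3)) R, ENNReal.ofReal (‖twistProfile t x‖ ^ 2) := by
  -- the volume of the ball of radius 1/2 as a positive real
  have hv0 : volume (ball (0 : EuclideanSpace ℝ (Fin 3)) (1 / 2)) ≠ 0 := (measure_ball_pos volume (0 : EuclideanSpace ℝ (Fin 3)) (by norm_num)).ne'
  have hvT : volume (ball (0 : EuclideanSpace ℝ (Fin 3)) (1 / 2)) ≠ ∞ := measure_ball_lt_top.ne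
  set v₀ : ℝ := (volume (ball (0 : EuclideanSpace ℝ (Fin 3)) (1 / 2))).toReal with hv₀
  have hv₀pos : 0 < v₀ := ENNReal.toReal_pos hv0 hvT
  set c : ℝ := 3 / 8 * cellAmp t ^ 2 with hc
  have hcpos : 0 < c := by have := cellAmp_pos ht; positivity
  -- choose N with 5 |K| < c v₀ (2N+1)²
  obtain ⟨N, hN⟩ := exists_nat_gt (5 * |K| / (c * v₀))
  have hN' : 5 * |K| < c * v₀ * (2 * N + 1) ^ 2 := by
    have h1 : 5 * |K| / (c * v₀) < (2 * N + 1) ^ 2 := by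
      have : (N : ℝ) ≤ (2 * N + 1) ^ 2 := by nlinarith
      linarith
    have h2 := (div_lt_iff₀ (mul_pos hcpos hv₀pos)).1 h1
    linarith
  refine ⟨9 * N + 5, by positivity, ?_⟩
  have hmain := energy_lower_bound t N
  refine lt_of_lt_of_le ?_ hmain
  -- rewrite the left-hand side of `hmain` as `ofReal` of a real number
  have hcast : (((2 * N + 1) ^ 3 : ℕ) : ℝ≥0∞) = ENNReal.ofReal (((2 * N + 1) ^ 3 : ℕ) : ℝ) := by
    rw [ENNReal.ofReal_natCast]
  have hvol : volume (ball (0 : EuclideanSpace ℝ (Fin 3)) (1 / 2)) = ENNReal.ofReal v₀ := by rw [hv₀, ENNReal.ofReal_toReal hvT]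
  rw [hcast, hvol, ← ENNReal.ofReal_mul (by positivity), ← ENNReal.ofReal_mul hcpos.le]
  have hpos : 0 < c * ((((2 * N + 1) ^ 3 : ℕ) : ℝ) * v₀) := by positivity
  rw [ENNReal.ofReal_lt_ofReal_iff hpos]
  have hK : K * (9 * N + 5) ≤ |K| * (5 * (2 * N + 1)) := by
    have h1 : K * (9 * N + 5) ≤ |K| * (9 * N + 5) := by
      exact mul_le_mul_of_nonneg_right (le_abs_self K) (by positivity)
    have h2 : |K| * (9 * N + 5) ≤ |K| * (5 * (2 * N + 1)) := by
      exact mul_le_mul_of_nonneg_left (by linarith) (abs_nonneg K)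
    linarith
  have hcube : (((2 * N + 1) ^ 3 : ℕ) : ℝ) = (2 * N + 1) ^ 2 * (2 * N + 1) := by push_cast; ring
  rw [hcube]
  nlinarith [hN', abs_nonneg K]

/-- **R3 (line `sparse_energy`, crux 19708): THE TWISTED COLUMN IS NOT SPARSE.**  For every time `t < 0` (where
`cellAmp t = (−t)^{-1/2} ≠ 0`) there is NO constant `K` with `∫⁻_{B_R(0)} ‖twistProfile t x‖² ≤ K·R` for all `R > 0`.
[folklore] -/
theorem twistProfile_not_sparse {t : ℝ} (ht : t < 0) :
    ¬ ∃ K : ℝ, ∀ R : ℝ, 0 < R →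
      (∫⁻ x in ball (0 : EuclideanSpace ℝ (Fin 3)) R, ENNReal.ofReal (‖twistProfile t x‖ ^ 2)) ≤ ENNReal.ofReal (K * R) := by
  rintro ⟨K, hK⟩
  obtain ⟨R, hR, hlt⟩ := exists_ball_energy_gt ht K
  exact (lt_irrefl _) (lt_of_lt_of_le hlt (hK R hR))

/-- **The conclusion of S1 (`stub_scaledEnergy`) FAILS for the twisted column** (`v = twistProfile`; both conjuncts, all
`t₀ < 0`, all centres and radii, verbatim shape): the class-level hypothesis that line `sparse_energy` adds to the twisting
residue (stub S2 `stub_twistingSparse`) excludes refuter1's (M)-free witness family K-47. [folklore] -/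
theorem twistProfile_not_scaledEnergy :
    ¬ ∃ K : ℝ, 0 ≤ K ∧ ∀ t₀ : ℝ, t₀ < 0 → ∀ (a : EuclideanSpace ℝ (Fin 3)) (R : ℝ), 0 < R →
        (∫⁻ x in Metric.ball a R, ENNReal.ofReal (‖twistProfile t₀ x‖ ^ 2)) ≤ ENNReal.ofReal (K * R) ∧
        (∫⁻ t in Set.Iio t₀, ∫⁻ x in Metric.ball a R, ENNReal.ofReal (‖fderiv ℝ (twistProfile t) x‖ ^ 2)) ≤
          ENNReal.ofReal (K * R) := by
  rintro ⟨K, -, hK⟩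
  refine twistProfile_not_sparse (t := -1) (by norm_num) ⟨K, fun R hR => ?_⟩
  exact (hK (-1) (by norm_num) 0 R hR).1

end Summit.NavierStokesRegularity.NavierStokesRegularity.Theorems.PoloidalWindowDoorPoloidalWindowRigiditySparseEnergyTwistProfileNotSparse

end
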